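import Summits.QuantumAdvantage.QuantumAdvantage.Theorems.CubicForrelationNearExactIsExactAmmCeilingQ
import Summits.QuantumAdvantage.QuantumAdvantage.Theorems.NearExactIsExact.Negative.SkewProductCore

/-!
# `NearExactIsExact` (stmt-QuantumAdvantage-14043), negative side — second derivatives of a cubic along an
# affine frame: the PARITY LEMMA of the corner-flat family

Negative-side support (disprover lane, unit `b2b-cforr-disprove-g33`, 2026-08-23) for the crux
`Summit.QuantumAdvantage.QuantumAdvantage.Theses.CubicForrelation.NearExactIsExact`; used by
`…Negative.CornerFlatParity` (the `15/16` ceiling for corner-flat pairs with a non-bent partner).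
HONEST FRAMING: VALUE = THEOREM (Boolean polar-form calculus) — NOT summit progress.

Notation (in the docstrings only; the statements are written out): `D²_{s,t}h(y) = h(y) ⊕ h(y⊕s) ⊕ h(y⊕t) ⊕
h(y⊕s⊕t)` (second derivative), `B_c(s,t) = c(0) ⊕ c(s) ⊕ c(t) ⊕ c(s⊕t)` (polar form), `D_y h = h ⊕ h(·⊕y)`.

**Parity lemma** (`cf_parity_deg`).  Let `h : 𝔽₂^{a+2} → 𝔽₂` be cubic and let `u, v, w : 𝔽₂^a → 𝔽₂^{a+2}` with
`u, v` coordinatewise AFFINE, `w` coordinatewise QUADRATIC, and affine Plücker coordinates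
`x₁ ↦ uᵢ(x₁)vⱼ(x₁) ⊕ uⱼ(x₁)vᵢ(x₁)`.  Then the second derivative along the moving frame,
`x₁ ↦ D²_{u(x₁),v(x₁)} h (w(x₁)) = ⊕_{σ,τ} h(w(x₁) ⊕ σu(x₁) ⊕ τv(x₁))`, has degree `≤ 3` (a priori `6`).
Proof: `D²_{s,t}h(y) = D²_{s,t}h(0) ⊕ B_{D_y h}(s,t)` (`cfD2_eq_polar`); `D²_{s,t}h(0)` is a cubic composed with
affine maps; `y ↦ B_{D_y h}(s,t)` is additive (the third derivative of a cubic, `cfT_additive`, via stub D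
`stub_derivDegree`), hence equals `Σ_l y_l·B_{D_{e_l}h}(s,t)` (`cf_additive_expand`); and an alternating bilinear
form is a linear function of the bivector, `B_c(s,t) = Σ_{i<j} (sᵢtⱼ ⊕ sⱼtᵢ) B_c(eᵢ,eⱼ)` (`cfPolar_expand_wedge`,
[cite: Carlet2020, §5.1]), so `B_{D_{e_l}h}(u(x₁),v(x₁))` is affine in `x₁` (`cfPolar_frame_deg`) and `w_l ·` it is
cubic.  Everything is a theorem over the standard three axioms.
-/

set_option linter.dupNamespace false -- D-0017: single-problem summit ⇒ `QuantumAdvantage.QuantumAdvantage` by design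

noncomputable section

namespace Summit.QuantumAdvantage.QuantumAdvantage.Theorems.NearExactIsExact.Negative.CornerFlatPolar

open Finset
open Literature.Computability.QuantumComplexity
open Literature.Computability.QuantumComplexity.BuzetChailloux (bxor zeroVec bxor_comm bxor_self zeroVec_bxor
  bxor_zeroVec)
open Summit.QuantumAdvantage.QuantumAdvantage.Theorems.CubicForrelation.NearExactIsExact
open Summit.QuantumAdvantage.QuantumAdvantage.Theorems.NearExactIsExact.Negative.SkewProductCore (ind ind_and ind_xor
  decide_ind_eq_one ind_decide_eq_one isDegLeFun_sum)

/-! ### Second derivatives of a cubic -/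

section Algebra

variable {k : ℕ}

/-- `D²_{s,t} h (y) = D²_{s,t} h (0) ⊕ B_{D_y h}(s,t)`: the base-point dependence of the second derivative is the
polar form of the first derivative `D_y h = h ⊕ h(· ⊕ y)`. [folklore] -/
theorem cfD2_eq_polar (h : (Fin k → Bool) → Bool) (s t y : Fin k → Bool) :
    (h y ^^ h (bxor y s) ^^ h (bxor y t) ^^ h (bxor y (bxor s t))) =
      ((h zeroVec ^^ h s ^^ h t ^^ h (bxor s t)) ^^
        ((h zeroVec ^^ h (bxor zeroVec y)) ^^ (h s ^^ h (bxor s y)) ^^ (h t ^^ h (bxor t y)) ^^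
          (h (bxor s t) ^^ h (bxor (bxor s t) y)))) := by
  simp only [zeroVec_bxor]
  rw [bxor_comm s y, bxor_comm t y, bxor_comm (bxor s t) y]
  cases h y <;> cases h (bxor y s) <;> cases h (bxor y t) <;> cases h (bxor y (bxor s t)) <;> cases h zeroVec <;>
    cases h s <;> cases h t <;> cases h (bxor s t) <;> rfl

/-- For cubic `h`, `y ↦ D²_{s,t} h (y)` has degree `≤ 1` (two discrete derivatives, stub D). [cite: Carlet2020, §2.2] -/
theorem cfD2_deg {h : (Fin k → Bool) → Bool} (hh : IsDegLeFun 3 h) (s t : Fin k → Bool) :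
    IsDegLeFun 1 (fun y => h y ^^ h (bxor y s) ^^ h (bxor y t) ^^ h (bxor y (bxor s t))) := by
  have h2 : IsDegLeFun 2 (fun y => h y ^^ h (bxor y s)) := stub_derivDegree k 2 h s hh
  have h1 : IsDegLeFun 1 (fun y => (h y ^^ h (bxor y s)) ^^ (h (bxor y t) ^^ h (bxor (bxor y t) s))) :=
    stub_derivDegree k 1 (fun y => h y ^^ h (bxor y s)) t h2
  refine rm_isDegLeFun_congr h1 fun y => ?_
  rw [acq_bxor_assoc, bxor_comm t s]
  cases h y <;> cases h (bxor y s) <;> cases h (bxor y t) <;> cases h (bxor y (bxor s t)) <;> rfl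

/-- The third derivative `y ↦ D²_{s,t} h (y) ⊕ D²_{s,t} h (0)` of a cubic is additive. [cite: Carlet2020, §2.2] -/
theorem cfT_additive {h : (Fin k → Bool) → Bool} (hh : IsDegLeFun 3 h) (s t y y' : Fin k → Bool) :
    ((h (bxor y y') ^^ h (bxor (bxor y y') s) ^^ h (bxor (bxor y y') t) ^^ h (bxor (bxor y y') (bxor s t))) ^^
        (h zeroVec ^^ h s ^^ h t ^^ h (bxor s t))) =
      (((h y ^^ h (bxor y s) ^^ h (bxor y t) ^^ h (bxor y (bxor s t))) ^^
          (h zeroVec ^^ h s ^^ h t ^^ h (bxor s t))) ^^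
        ((h y' ^^ h (bxor y' s) ^^ h (bxor y' t) ^^ h (bxor y' (bxor s t))) ^^
          (h zeroVec ^^ h s ^^ h t ^^ h (bxor s t)))) := by
  have key := acq_affine_of_deg_one (cfD2_deg hh s t) y y'
  simp only [zeroVec_bxor] at key
  rw [key]
  cases (h y ^^ h (bxor y s) ^^ h (bxor y t) ^^ h (bxor y (bxor s t))) <;>
    cases (h y' ^^ h (bxor y' s) ^^ h (bxor y' t) ^^ h (bxor y' (bxor s t))) <;>
    cases (h zeroVec ^^ h s ^^ h t ^^ h (bxor s t)) <;> rfl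

/-- An ADDITIVE Boolean function is the linear form with its own values on the unit vectors as coefficients:
`L(y) = Σ_l y_l L(e_l)` over `𝔽₂`. [folklore] -/
theorem cf_additive_expand {L : (Fin k → Bool) → Bool} (hL : ∀ x t, L (bxor x t) = (L x ^^ L t))
    (y : Fin k → Bool) : L y = decide ((∑ l : Fin k, ind (y l && L (Pi.single l true))) = 1) := by
  classical
  refine acq_additive_ext (L' := fun y => decide ((∑ l : Fin k, ind (y l && L (Pi.single l true))) = 1)) hL ?_ ?_ y
  · intro x t
    have e : ∑ l : Fin k, ind (bxor x t l && L (Pi.single l true)) =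
        ∑ l : Fin k, ind (x l && L (Pi.single l true)) + ∑ l : Fin k, ind (t l && L (Pi.single l true)) := by
      rw [← sum_add_distrib]
      refine sum_congr rfl fun l _ => ?_
      simp only [bxor]
      cases x l <;> cases t l <;> cases L (Pi.single l true) <;> decide
    rw [e, zmod2_decide_add]
  · intro i
    rw [Finset.sum_eq_single i]
    · simp [decide_ind_eq_one]
    · intro l _ hl
      have e : (Pi.single i true : Fin k → Bool) l = false := by
        rw [Pi.single_eq_of_ne hl]; rfl
      rw [e]; cases L (Pi.single l true) <;> rfl
    · intro hi; exact absurd (mem_univ i) hi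

/-! ### The polar form of a quadratic -/

/-- The polar form is symmetric. -/
theorem cfPolar_comm (c : (Fin k → Bool) → Bool) (s t : Fin k → Bool) :
    (c zeroVec ^^ c s ^^ c t ^^ c (bxor s t)) = (c zeroVec ^^ c t ^^ c s ^^ c (bxor t s)) := by
  rw [bxor_comm s t]
  cases c zeroVec <;> cases c s <;> cases c t <;> cases c (bxor t s) <;> rfl

/-- The polar form is alternating: `B_c(s,s) = 0`. -/
theorem cfPolar_self (c : (Fin k → Bool) → Bool) (s : Fin k → Bool) :
    (c zeroVec ^^ c s ^^ c s ^^ c (bxor s s)) = false := by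
  rw [bxor_self]
  cases c zeroVec <;> cases c s <;> rfl

/-- **Coordinate expansion of the polar form** of a quadratic `c`: `B_c(s,t) = Σ_{i,j} sᵢ tⱼ B_c(eᵢ,eⱼ)`.
[cite: Carlet2020, §5.1] -/
theorem cfPolar_expand {c : (Fin k → Bool) → Bool} (hc : IsDegLeFun 2 c) (s t : Fin k → Bool) :
    (c zeroVec ^^ c s ^^ c t ^^ c (bxor s t)) = decide ((∑ i : Fin k, ∑ j : Fin k,
      ind (s i && t j && (c zeroVec ^^ c (Pi.single i true) ^^ c (Pi.single j true) ^^
        c (bxor (Pi.single i true) (Pi.single j true))))) = 1) := by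
  have addR : ∀ s x x' : Fin k → Bool, (c zeroVec ^^ c s ^^ c (bxor x x') ^^ c (bxor s (bxor x x'))) =
      ((c zeroVec ^^ c s ^^ c x ^^ c (bxor s x)) ^^ (c zeroVec ^^ c s ^^ c x' ^^ c (bxor s x'))) :=
    fun s x x' => acq_polar_add hc s x x'
  have addL : ∀ t x x' : Fin k → Bool, (c zeroVec ^^ c (bxor x x') ^^ c t ^^ c (bxor (bxor x x') t)) =
      ((c zeroVec ^^ c x ^^ c t ^^ c (bxor x t)) ^^ (c zeroVec ^^ c x' ^^ c t ^^ c (bxor x' t))) := fun t x x' => by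
    rw [cfPolar_comm, cfPolar_comm c x, cfPolar_comm c x']; exact addR t x x'
  rw [cf_additive_expand (L := fun x => (c zeroVec ^^ c x ^^ c t ^^ c (bxor x t))) (addL t) s]
  congr 2
  refine sum_congr rfl fun i _ => ?_
  rw [cf_additive_expand (L := fun x => (c zeroVec ^^ c (Pi.single i true) ^^ c x ^^ c (bxor (Pi.single i true) x)))
    (addR (Pi.single i true)) t]
  rw [ind_and, ind_decide_eq_one, mul_sum]
  refine sum_congr rfl fun j _ => ?_
  rw [ind_and, ind_and, ind_and, mul_assoc]

/-- Splitting a double sum over ordered pairs with vanishing diagonal into unordered pairs. [folklore] -/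
theorem cf_sum_pairs_split (F : Fin k → Fin k → ZMod 2) (hdiag : ∀ i, F i i = 0) :
    ∑ i, ∑ j, F i j = ∑ i, ∑ j, (if i < j then F i j + F j i else 0) := by
  have e : ∀ i j, F i j = (if i < j then F i j else 0) + (if j < i then F i j else 0) := by
    intro i j
    rcases lt_trichotomy i j with hij | rfl | hji
    · rw [if_pos hij, if_neg (lt_asymm hij), add_zero]
    · rw [if_neg (lt_irrefl _), add_zero, hdiag]
    · rw [if_neg (lt_asymm hji), if_pos hji, zero_add]
  calc ∑ i, ∑ j, F i j = ∑ i, ∑ j, ((if i < j then F i j else 0) + (if j < i then F i j else 0)) :=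
        sum_congr rfl fun i _ => sum_congr rfl fun j _ => e i j
    _ = (∑ i, ∑ j, if i < j then F i j else 0) + ∑ i, ∑ j, (if j < i then F i j else 0) := by
        rw [← sum_add_distrib]; exact sum_congr rfl fun i _ => sum_add_distrib
    _ = (∑ i, ∑ j, if i < j then F i j else 0) + ∑ j, ∑ i, (if j < i then F i j else 0) := by
        rw [Finset.sum_comm (f := fun i j => if j < i then F i j else 0)]
    _ = ∑ i, ∑ j, (if i < j then F i j + F j i else 0) := by
        rw [← sum_add_distrib]
        refine sum_congr rfl fun i _ => ?_
        rw [← sum_add_distrib]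
        refine sum_congr rfl fun j _ => ?_
        split_ifs <;> simp

/-- **The polar form in Plücker coordinates**: `B_c(s,t) = Σ_{i<j} (sᵢtⱼ ⊕ sⱼtᵢ) B_c(eᵢ,eⱼ)` — an alternating bilinear
form is a linear function of the bivector `s ∧ t`. [cite: Carlet2020, §5.1] -/
theorem cfPolar_expand_wedge {c : (Fin k → Bool) → Bool} (hc : IsDegLeFun 2 c) (s t : Fin k → Bool) :
    (c zeroVec ^^ c s ^^ c t ^^ c (bxor s t)) = decide ((∑ i : Fin k, ∑ j : Fin k,
      (if i < j then ind ((((s i && t j) ^^ (s j && t i))) && (c zeroVec ^^ c (Pi.single i true) ^^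
        c (Pi.single j true) ^^ c (bxor (Pi.single i true) (Pi.single j true)))) else 0)) = 1) := by
  rw [cfPolar_expand hc, cf_sum_pairs_split]
  · congr 2
    refine sum_congr rfl fun i _ => sum_congr rfl fun j _ => ?_
    split_ifs
    · rw [cfPolar_comm c (Pi.single j true) (Pi.single i true)]
      cases s i <;> cases t j <;> cases s j <;> cases t i <;>
        cases (c zeroVec ^^ c (Pi.single i true) ^^ c (Pi.single j true) ^^
          c (bxor (Pi.single i true) (Pi.single j true))) <;> decide
    · rfl
  · intro i
    rw [cfPolar_self]
    cases s i <;> cases t i <;> rfl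

/-- **Moving frames**: for quadratic `c` and maps `u, v` whose Plücker coordinates `x ↦ uᵢvⱼ ⊕ uⱼvᵢ` are affine,
`x ↦ B_c(u(x), v(x))` is affine. -/
theorem cfPolar_frame_deg {m : ℕ} {c : (Fin k → Bool) → Bool} (hc : IsDegLeFun 2 c)
    {u v : (Fin m → Bool) → (Fin k → Bool)}
    (hwedge : ∀ i j, IsDegLeFun 1 (fun x => (u x i && v x j) ^^ (u x j && v x i))) :
    IsDegLeFun 1 (fun x => c zeroVec ^^ c (u x) ^^ c (v x) ^^ c (bxor (u x) (v x))) := by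
  classical
  refine rm_isDegLeFun_congr ?_ (fun x => (cfPolar_expand_wedge hc (u x) (v x)).symm)
  refine isDegLeFun_sum (fun i x => ∑ j : Fin k,
    (if i < j then ind ((((u x i && v x j) ^^ (u x j && v x i))) && (c zeroVec ^^ c (Pi.single i true) ^^
      c (Pi.single j true) ^^ c (bxor (Pi.single i true) (Pi.single j true)))) else 0)) univ fun i _ => ?_
  refine isDegLeFun_sum (fun j x =>
    (if i < j then ind ((((u x i && v x j) ^^ (u x j && v x i))) && (c zeroVec ^^ c (Pi.single i true) ^^
      c (Pi.single j true) ^^ c (bxor (Pi.single i true) (Pi.single j true)))) else 0)) univ fun j _ => ?_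
  by_cases hij : i < j
  · simp only [if_pos hij, decide_ind_eq_one]
    exact acq_deg_band (hwedge i j) (isDegLeFun_const 0 _) (by norm_num)
  · simp only [if_neg hij]
    exact isDegLeFun_const 1 _

end Algebra

/-! ### The parity lemma -/

variable {a : ℕ}

/-- **Parity lemma.**  For cubic `h`, affine `u, v`, coordinatewise-quadratic `w` and AFFINE Plücker coordinates
`x₁ ↦ uᵢvⱼ ⊕ uⱼvᵢ`, the second derivative along the moving frame `x₁ ↦ D²_{u(x₁),v(x₁)} h (w(x₁))` (the parity
of `h` over the four corners `w(x₁) ⊕ σu(x₁) ⊕ τv(x₁)`) has degree `≤ 3`: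
`D²_{u,v}h(w) = D²_{u,v}h(0) ⊕ Σ_l w_l · B_{D_{e_l}h}(u,v)` with `D²_{u(x),v(x)}h(0)` cubic (a cubic composed with
affine maps) and each `B_{D_{e_l}h}(u(x),v(x))` AFFINE in `x` (`cfPolar_frame_deg`). [folklore] -/
theorem cf_parity_deg {h : (Fin (a + 2) → Bool) → Bool} (hh : IsDegLeFun 3 h)
    {u v w : (Fin a → Bool) → (Fin (a + 2) → Bool)}
    (hu : ∀ j, IsDegLeFun 1 (fun x₁ => u x₁ j)) (hv : ∀ j, IsDegLeFun 1 (fun x₁ => v x₁ j))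
    (hw : ∀ j, IsDegLeFun 2 (fun x₁ => w x₁ j))
    (hwedge : ∀ i j, IsDegLeFun 1 (fun x₁ => (u x₁ i && v x₁ j) ^^ (u x₁ j && v x₁ i))) :
    IsDegLeFun 3 (fun x₁ => h (w x₁) ^^ h (bxor (w x₁) (u x₁)) ^^ h (bxor (w x₁) (v x₁)) ^^
      h (bxor (w x₁) (bxor (u x₁) (v x₁)))) := by
  classical
  -- step 1: expand the base-point dependence additively in `w`
  have hT : ∀ x₁, (h (w x₁) ^^ h (bxor (w x₁) (u x₁)) ^^ h (bxor (w x₁) (v x₁)) ^^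
      h (bxor (w x₁) (bxor (u x₁) (v x₁)))) = ((h zeroVec ^^ h (u x₁) ^^ h (v x₁) ^^ h (bxor (u x₁) (v x₁))) ^^
      decide ((∑ l : Fin (a + 2), ind (w x₁ l &&
        ((h (Pi.single l true) ^^ h (bxor (Pi.single l true) (u x₁)) ^^ h (bxor (Pi.single l true) (v x₁)) ^^
            h (bxor (Pi.single l true) (bxor (u x₁) (v x₁)))) ^^
          (h zeroVec ^^ h (u x₁) ^^ h (v x₁) ^^ h (bxor (u x₁) (v x₁)))))) = 1)) := by
    intro x₁
    have key := cf_additive_expand (L := fun y => (h y ^^ h (bxor y (u x₁)) ^^ h (bxor y (v x₁)) ^^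
        h (bxor y (bxor (u x₁) (v x₁)))) ^^ (h zeroVec ^^ h (u x₁) ^^ h (v x₁) ^^ h (bxor (u x₁) (v x₁))))
      (fun y y' => cfT_additive hh _ _ y y') (w x₁)
    rw [← key]
    cases (h (w x₁) ^^ h (bxor (w x₁) (u x₁)) ^^ h (bxor (w x₁) (v x₁)) ^^ h (bxor (w x₁) (bxor (u x₁) (v x₁)))) <;>
      cases (h zeroVec ^^ h (u x₁) ^^ h (v x₁) ^^ h (bxor (u x₁) (v x₁))) <;> rfl
  -- step 2: the coefficient of `w_l` is the polar form of the quadratic `D_{e_l} h`, affine along the frame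
  have hcl : ∀ l : Fin (a + 2), IsDegLeFun 2 (fun z => h z ^^ h (bxor z (Pi.single l true))) :=
    fun l => stub_derivDegree _ 2 h _ hh
  have hTl : ∀ (s t : Fin (a + 2) → Bool) (l : Fin (a + 2)),
      ((h (Pi.single l true) ^^ h (bxor (Pi.single l true) s) ^^ h (bxor (Pi.single l true) t) ^^
            h (bxor (Pi.single l true) (bxor s t))) ^^ (h zeroVec ^^ h s ^^ h t ^^ h (bxor s t))) =
        ((h zeroVec ^^ h (bxor zeroVec (Pi.single l true))) ^^ (h s ^^ h (bxor s (Pi.single l true))) ^^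
          (h t ^^ h (bxor t (Pi.single l true))) ^^ (h (bxor s t) ^^ h (bxor (bxor s t) (Pi.single l true)))) := by
    intro s t l
    rw [cfD2_eq_polar h s t (Pi.single l true)]
    cases (h zeroVec ^^ h s ^^ h t ^^ h (bxor s t)) <;>
      cases ((h zeroVec ^^ h (bxor zeroVec (Pi.single l true))) ^^ (h s ^^ h (bxor s (Pi.single l true))) ^^
        (h t ^^ h (bxor t (Pi.single l true))) ^^ (h (bxor s t) ^^ h (bxor (bxor s t) (Pi.single l true)))) <;> rfl
  have hdeg1 : ∀ l : Fin (a + 2), IsDegLeFun 1 (fun x₁ =>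
      (h zeroVec ^^ h (bxor zeroVec (Pi.single l true))) ^^ (h (u x₁) ^^ h (bxor (u x₁) (Pi.single l true))) ^^
        (h (v x₁) ^^ h (bxor (v x₁) (Pi.single l true))) ^^
        (h (bxor (u x₁) (v x₁)) ^^ h (bxor (bxor (u x₁) (v x₁)) (Pi.single l true)))) :=
    fun l => cfPolar_frame_deg (hcl l) hwedge
  -- step 3: assemble
  refine rm_isDegLeFun_congr ?_ (fun x₁ => (hT x₁).symm)
  refine fc_deg_bxor ?_ ?_
  · refine fc_deg_bxor (fc_deg_bxor (fc_deg_bxor (isDegLeFun_const 3 _) ?_) ?_) ?_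
    · exact fc_isDegLeFun_comp (D := 1) (K := 3) hh (fun x₁ => u x₁) hu (by norm_num)
    · exact fc_isDegLeFun_comp (D := 1) (K := 3) hh (fun x₁ => v x₁) hv (by norm_num)
    · refine fc_isDegLeFun_comp (D := 1) (K := 3) hh (fun x₁ => bxor (u x₁) (v x₁)) (fun j => ?_) (by norm_num)
      simp only [bxor]
      exact fc_deg_bxor (hu j) (hv j)
  · refine isDegLeFun_sum (fun l x₁ => ind (w x₁ l &&
        ((h (Pi.single l true) ^^ h (bxor (Pi.single l true) (u x₁)) ^^ h (bxor (Pi.single l true) (v x₁)) ^^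
            h (bxor (Pi.single l true) (bxor (u x₁) (v x₁)))) ^^
          (h zeroVec ^^ h (u x₁) ^^ h (v x₁) ^^ h (bxor (u x₁) (v x₁)))))) univ fun l _ => ?_
    simp only [decide_ind_eq_one, hTl]
    exact acq_deg_band (hw l) (hdeg1 l) (by norm_num)

end Summit.QuantumAdvantage.QuantumAdvantage.Theorems.NearExactIsExact.Negative.CornerFlatPolar
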